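import Literature.NumberTheory.ComplexMultiplication.CMTypeRankPartition
import Literature.NumberTheory.ComplexMultiplication.PartialConjugationOfRealIntersection
import HarnessLib

/-!
# Nondegeneracy of a family of CM types is decided on the blocks of ANY partition whose Galois closures PAIRWISE meet
# in totally real fields

Family `hodge`, layer `Literature/AlgebraicGeometry/Pohlmann1968`; KERNEL ONLY (theorems; no definition, no named
fact).  Number-field dress of `NumberTheory/ComplexMultiplication/CMTypeRankPartition` (the pairwise criterion BETWEEN
BLOCKS for an abstract family of CM types) for `G = Aut(ℂ)` acting on `⊔_i Hom(K_i, ℂ)`, in the vocabulary of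
`Pohlmann1968/NondegenerateCMAlgebraTypes` (`CMAlgebra.cmFamilyRank`, `CMAlgebra.IsNondegenerateFamily`: the family
`(Φ_i)_i` is nondegenerate iff `rank = Σ_i [K_i:ℚ]/2 + 1`, iff no product `∏_i A_{Φ_i}^{k_i}` carries an exceptional Hodge
class).  Cell `pub-hodgecm2` (COR-CM), count-neutral (seat p2); HONEST FRAMING: an unconditional structure theorem on
Mumford–Tate groups of CM abelian varieties, not a step of the summit chain.

THE CRITERION.  Let `κ : I → C` be any surjection (a partition of the slots into blocks `κ⁻¹(c)`), and for a block `c`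
let `L_c = ∏_{κ i = c} K_i^{gal} ≤ ℂ` be the compositum of the Galois closures of its fields.  If for all `c ≠ c'`
complex conjugation fixes `L_c ∩ L_{c'}` POINTWISE (the two composita meet in a totally real field — nothing is asked
about `L_c ∩ ∏_{c'' ≠ c} L_{c''}`), then

* `exists_partialConj_fiber_of_conj_apply_eq` — every ordered pair of distinct blocks carries a PARTIAL CONJUGATION
  (`σ ∈ Aut(ℂ)`: `σ ∘ s = s̄` on every `Hom(K_i, ℂ)` with `κ i = c`, `σ ∘ t = t` on every `Hom(K_i, ℂ)` with `κ i = c'`;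
  the gluing lemma `exists_ringEquiv_apply_eq_of_normal`);
* `cmFamilyRank_add_card_eq_of_conj_apply_eq_fiber` — **`rank((Φ_i)_i) + |C| = Σ_c rank((Φ_i)_{κ i = c}) + 1`**, i.e.
  `Hg(∏_i A_i) = ∏_c Hg(∏_{κ i = c} A_i)`;
* `isNondegenerateFamily_iff_forall_fiber_of_conj_apply_eq` — **`(Φ_i)_i` is nondegenerate iff every block
  sub-family `(Φ_i)_{κ i = c}` is**; `hodgeConjectureFor_prod_of_forall_fiber` — hence the Hodge conjecture and
  `B• = D•` on every `∏_j A_{π j}` as soon as every block sub-family is nondegenerate.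

Independently of any hypothesis between the blocks, `IsNondegenerateFamily.fiber` — **every block of a nondegenerate
family is nondegenerate** (`typeRank_sigmaType_fiber_eq_of_eq`; Hazama's remark on sub-products, Gordon 7.6.1).
The partial-conjugation forms (`…_of_partialConj_fiber`) are recorded too.  Special cases already in the tree: blocks =
singletons with one `σ_i` trivial on ALL other slots (`Pohlmann1968`-consumers of `CMTypeRankPartialConjugation`), two
blocks (`HodgeClassesProductSpanCMProductsRealIntersection`), pairwise between SLOTS (`Summits/…/CorCM/PairwiseCMFamiliesHodge`).
The new freedom — several slots inside one block, conditions only between PAIRS of blocks — is what products of simple CM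
abelian surfaces need (`Summits/…/CorCM/SimpleCMSurfaceProductsHodge`: blocks = Galois-closure classes).

## References
* [MoonenZarhin1999LowDim] B. Moonen, Yu. Zarhin, Math. Ann. 315 (1999) 711–733, §3 (3.1), (3.9).
* [Gordon1999HodgeAVSurvey] B. B. Gordon, *A survey of the Hodge conjecture for abelian varieties*, §3 Theorem (Imai,
  Murty) with proof; 7.5–7.7.
* [Lang2002] S. Lang, *Algebra*, GTM 211, VI §1 Thm. 1.14, V §2 Thm. 2.8.
-/

noncomputable section

open IntermediateField

/-! ### §1 Partial conjugations between blocks from totally real intersections -/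

namespace Literature.NumberTheory.ComplexMultiplication

section Blocks

variable {I : Type} {K : I → Type} [∀ i, Field (K i)] [∀ i, NumberField (K i)] {C : Type}

/-- **A partial conjugation for every ordered pair of distinct blocks.**  If complex conjugation fixes pointwise the
intersection `(∏_{κ i = c} L_i) ∩ (∏_{κ i = c'} L_i)` of the composita of the Galois closures `L_i = normalClosure ℚ K_i ℂ`
of two distinct blocks `c ≠ c'`, then some `σ ∈ Aut(ℂ)` is complex conjugation on every embedding of every `K_i` with
`κ i = c` and the identity on every embedding of every `K_i` with `κ i = c'` (in `Gal(L_c L_{c'}/ℚ)` the pair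
`(ρ|_{L_c}, id_{L_{c'}})` agrees on `L_c ∩ L_{c'}`). [cite: Lang2002, VI §1 Thm. 1.14 and V §2 Thm. 2.8]
[cite: Gordon1999HodgeAVSurvey, §3 Theorem (Imai, Murty), proof] -/
theorem exists_partialConj_fiber_of_conj_apply_eq [Finite I] (κ : I → C)
    (hreal : ∀ c c', c ≠ c' → ∀ x : ℂ, x ∈ (⨆ i : {i : I // κ i = c}, normalClosure ℚ (K i.1) ℂ) →
      x ∈ (⨆ i : {i : I // κ i = c'}, normalClosure ℚ (K i.1) ℂ) → starRingEnd ℂ x = x) :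
    ∀ c c', c ≠ c' → ∃ σ : ℂ ≃+* ℂ, (∀ i, κ i = c → ∀ s : K i →+* ℂ, σ • s = (starRingAut : ℂ ≃+* ℂ) • s) ∧
      (∀ i, κ i = c' → ∀ s : K i →+* ℂ, σ • s = s) := by
  intro c c' hcc'
  haveI : ∀ j : I, @Normal ℚ ↥(normalClosure ℚ (K j) ℂ) _ _ (IntermediateField.algebra' _) :=
    normal_normalClosure_complex
  obtain ⟨τ, hA, hB⟩ := exists_ringEquiv_apply_eq_of_normal
    (A := ⨆ i : {i : I // κ i = c}, normalClosure ℚ (K i.1) ℂ)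
    (B := ⨆ i : {i : I // κ i = c'}, normalClosure ℚ (K i.1) ℂ) (starRingAut : ℂ ≃+* ℂ)
    (fun x h₁ h₂ => by rw [starRingAut_apply, ← starRingEnd_apply]; exact hreal c c' hcc' x h₁ h₂)
  refine ⟨τ, fun i hi s => RingHom.ext fun x => ?_, fun i hi s => RingHom.ext fun x => hB _ ?_⟩
  · rw [ringEquiv_smul_apply, ringEquiv_smul_apply]
    exact hA _ ((le_iSup (fun i : {i : I // κ i = c} => normalClosure ℚ (K i.1) ℂ) ⟨i, hi⟩ :
      normalClosure ℚ (K i) ℂ ≤ _) (apply_mem_normalClosure i s x))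
  · exact (le_iSup (fun i : {i : I // κ i = c'} => normalClosure ℚ (K i.1) ℂ) ⟨i, hi⟩ :
      normalClosure ℚ (K i) ℂ ≤ _) (apply_mem_normalClosure i s x)

end Blocks

/-! ### §1b Every block of a nondegenerate family is nondegenerate (no hypothesis between the blocks) -/

section Inherit

variable {G : Type*} [Group G] {I : Type*} {E : I → Type*} [∀ i, MulAction G (E i)] {C : Type*}
  [Fintype I] [Fintype C] [DecidableEq C] [∀ i, Fintype (E i)] [Nonempty I] [∀ i, Nonempty (E i)]

/-- **`rank(Σ) + |C| ≤ Σ_c rank(Σ|_c) + 1` for EVERY partition** (`Hg(∏_i A_i) ⊆ ∏_c Hg(∏_{κ i = c} A_i)`): the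
family bound `typeRank_sigmaType_add_card_le` for the regrouped family. [cite: Gordon1999HodgeAVSurvey, 7.7] -/
theorem typeRank_sigmaType_add_card_le_fiber {ρ : G} {Φ : ∀ i, Set (E i)} (h : ∀ i, IsCMTypeWith ρ (Φ i))
    (κ : I → C) (hκ : Function.Surjective κ) :
    typeRank G (sigmaType Φ) + Fintype.card C ≤
      (∑ c, typeRank G (sigmaType fun i : {i // κ i = c} => Φ i.1)) + 1 := by
  haveI : Nonempty C := ⟨κ (Classical.arbitrary I)⟩
  haveI : ∀ c, Nonempty (Σ i : {i // κ i = c}, E i.1) := fun c => by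
    obtain ⟨i, hi⟩ := hκ c
    exact ⟨⟨⟨i, hi⟩, Classical.arbitrary (E i)⟩⟩
  have key := typeRank_sigmaType_add_card_le (G := G) (Φ := fun c => sigmaType fun i : {i // κ i = c} => Φ i.1)
    (fun c => isCMTypeWith_sigmaType_fiber h κ c)
  rwa [typeRank_sigmaType_fiber] at key

/-- **Every block of a nondegenerate family is nondegenerate, for EVERY partition** — Hazama's «an abelian subvariety of
a stably nondegenerate abelian variety is stably nondegenerate» in block form: if `rank(Σ) = |⊔_i E_i|/2 + 1` then
`rank(Σ|_c) = |⊔_{κ i = c} E_i|/2 + 1` for every block `c` (each block rank is at most its maximum, and the sum of the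
maxima is forced). [cite: Gordon1999HodgeAVSurvey, 7.6.1] -/
theorem typeRank_sigmaType_fiber_eq_of_eq {ρ : G} {Φ : ∀ i, Set (E i)} (h : ∀ i, IsCMTypeWith ρ (Φ i))
    (κ : I → C) (hκ : Function.Surjective κ)
    (hnd : typeRank G (sigmaType Φ) = Fintype.card (Σ i, E i) / 2 + 1) (c : C) :
    typeRank G (sigmaType fun i : {i // κ i = c} => Φ i.1) = Fintype.card (Σ i : {i // κ i = c}, E i.1) / 2 + 1 := by
  haveI : ∀ c, Nonempty (Σ i : {i // κ i = c}, E i.1) := fun c => by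
    obtain ⟨i, hi⟩ := hκ c
    exact ⟨⟨⟨i, hi⟩, Classical.arbitrary (E i)⟩⟩
  have hsum := typeRank_sigmaType_add_card_le_fiber h κ hκ
  have hle : ∀ c', typeRank G (sigmaType fun i : {i // κ i = c'} => Φ i.1) ≤
      Fintype.card (Σ i : {i // κ i = c'}, E i.1) / 2 + 1 :=
    fun c' => (isCMTypeWith_sigmaType_fiber h κ c').typeRank_le
  have htot : ∑ c', (Fintype.card (Σ i : {i // κ i = c'}, E i.1) / 2 + 1) =
      (∑ c', Fintype.card (Σ i : {i // κ i = c'}, E i.1) / 2) + Fintype.card C := by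
    rw [Finset.sum_add_distrib, Finset.sum_const, Finset.card_univ, smul_eq_mul, mul_one]
  have hcard : Fintype.card (Σ i, E i) / 2 = ∑ c', Fintype.card (Σ i : {i // κ i = c'}, E i.1) / 2 := by
    rw [← card_sigma_fiber (E := E) κ]
    exact card_sigma_div_two fun c' => isCMTypeWith_sigmaType_fiber h κ c'
  by_contra hne
  have hlt : typeRank G (sigmaType fun i : {i // κ i = c} => Φ i.1) <
      Fintype.card (Σ i : {i // κ i = c}, E i.1) / 2 + 1 := lt_of_le_of_ne (hle c) hne
  have hsum_lt : ∑ c', typeRank G (sigmaType fun i : {i // κ i = c'} => Φ i.1) <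
      ∑ c', (Fintype.card (Σ i : {i // κ i = c'}, E i.1) / 2 + 1) :=
    Finset.sum_lt_sum (fun c' _ => hle c') ⟨c, Finset.mem_univ c, hlt⟩
  rw [htot, ← hcard] at hsum_lt
  omega

end Inherit

end Literature.NumberTheory.ComplexMultiplication

/-! ### §2 The CM dress: `cmFamilyRank` and `IsNondegenerateFamily` along a partition -/

namespace Literature.AlgebraicGeometry.Pohlmann1968

namespace CMAlgebra

open Literature.NumberTheory.ComplexMultiplication
open Literature.AlgebraicGeometry.Motives (AbelianVariety CMType)
open Literature.AlgebraicGeometry.HodgeTheory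
open Literature.AlgebraicGeometry.ComplexMultiplication (IsCMTypeRealisation)
open Literature.AlgebraicGeometry.VanGeemen1994 (hodgeClassSpan)
open Literature.Barriers.HodgeConjecture (divisorClassesSpan)
open CategoryTheory CategoryTheory.Limits NumberField

variable {I : Type} {K : I → Type} [∀ i, Field (K i)] [∀ i, NumberField (K i)] [∀ i, IsCMField (K i)]
  [Fintype I] {C : Type} [Fintype C] [DecidableEq C]

omit [∀ i, IsCMField (K i)] in
/-- `|⊔_i Hom(K_i, ℂ)| = Σ_i [K_i : ℚ]`. [folklore] -/
private theorem card_sigma_ringHom_eq_sum_finrank :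
    Fintype.card ((i : I) × (K i →+* ℂ)) = ∑ i, Module.finrank ℚ (K i) := by
  rw [Fintype.card_sigma]
  exact Finset.sum_congr rfl fun i _ => Embeddings.card (K i) ℂ

/-- **Rank additivity over the blocks from partial conjugations between blocks**: for a surjection `κ : I → C` such that
every ordered pair of distinct blocks carries a partial conjugation, `rank((Φ_i)_i) + |C| = Σ_c rank((Φ_i)_{κ i = c}) + 1`
(`Hg(∏_i A_i) = ∏_c Hg(∏_{κ i = c} A_i)`). [cite: MoonenZarhin1999LowDim, §3 (3.1)] [cite: Gordon1999HodgeAVSurvey, §3 Theorem (1)] -/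
theorem cmFamilyRank_add_card_eq_of_partialConj_fiber [Nonempty I] (Φ : ∀ i, CMType (K i)) (κ : I → C)
    (hκ : Function.Surjective κ)
    (hσ : ∀ c c', c ≠ c' → ∃ σ : ℂ ≃+* ℂ, (∀ i, κ i = c → ∀ s : K i →+* ℂ, σ • s = (starRingAut : ℂ ≃+* ℂ) • s) ∧
      (∀ i, κ i = c' → ∀ s : K i →+* ℂ, σ • s = s)) :
    cmFamilyRank Φ + Fintype.card C = (∑ c, cmFamilyRank fun i : {i : I // κ i = c} => Φ i.1) + 1 :=
  typeRank_sigmaType_add_card_eq_of_partialConj_fiber (G := ℂ ≃+* ℂ) (Φ := fun i => (Φ i).1)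
    (fun i => isCMTypeWith_conj (Φ i)) κ hκ hσ

/-- **Nondegeneracy is decided block by block** when every ordered pair of distinct blocks carries a partial conjugation:
`(Φ_i)_i` is nondegenerate iff every block sub-family `(Φ_i)_{κ i = c}` is.
[cite: MoonenZarhin1999LowDim, §3 (3.1)] [cite: Gordon1999HodgeAVSurvey, 7.5] -/
theorem isNondegenerateFamily_iff_forall_fiber_of_partialConj [Nonempty I] (Φ : ∀ i, CMType (K i)) (κ : I → C)
    (hκ : Function.Surjective κ)
    (hσ : ∀ c c', c ≠ c' → ∃ σ : ℂ ≃+* ℂ, (∀ i, κ i = c → ∀ s : K i →+* ℂ, σ • s = (starRingAut : ℂ ≃+* ℂ) • s) ∧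
      (∀ i, κ i = c' → ∀ s : K i →+* ℂ, σ • s = s)) :
    IsNondegenerateFamily Φ ↔ ∀ c, IsNondegenerateFamily fun i : {i : I // κ i = c} => Φ i.1 := by
  have key := typeRank_sigmaType_eq_iff_forall_fiber_of_partialConj (G := ℂ ≃+* ℂ) (Φ := fun i => (Φ i).1)
    (fun i => isCMTypeWith_conj (Φ i)) κ hκ hσ
  rw [isNondegenerateFamily_iff, ← card_sigma_ringHom_eq_sum_finrank (K := K)]
  refine key.trans (forall_congr' fun c => ?_)
  rw [isNondegenerateFamily_iff, ← card_sigma_ringHom_eq_sum_finrank (K := fun i : {i : I // κ i = c} => K i.1)]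
  exact Iff.rfl


/-- **Every block of a nondegenerate family of CM types is nondegenerate**, for EVERY partition of the slots and with
NO hypothesis between the blocks (`∏_{κ i = c} A_i` is a sub-product of the stably nondegenerate `∏_i A_i`).
[cite: Gordon1999HodgeAVSurvey, 7.6.1] -/
theorem IsNondegenerateFamily.fiber [Nonempty I] {Φ : ∀ i, CMType (K i)} (hΦ : IsNondegenerateFamily Φ) (κ : I → C)
    (hκ : Function.Surjective κ) (c : C) : IsNondegenerateFamily fun i : {i : I // κ i = c} => Φ i.1 := by
  rw [isNondegenerateFamily_iff, ← card_sigma_ringHom_eq_sum_finrank (K := fun i : {i : I // κ i = c} => K i.1)]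
  rw [isNondegenerateFamily_iff, ← card_sigma_ringHom_eq_sum_finrank (K := K)] at hΦ
  exact typeRank_sigmaType_fiber_eq_of_eq (G := ℂ ≃+* ℂ) (Φ := fun i => (Φ i).1) (fun i => isCMTypeWith_conj (Φ i))
    κ hκ hΦ c

/-- **Rank additivity over the blocks of a partition whose composita of Galois closures PAIRWISE meet in totally real
fields**: `rank((Φ_i)_i) + |C| = Σ_c rank((Φ_i)_{κ i = c}) + 1`. [cite: MoonenZarhin1999LowDim, §3 (3.1)]
[cite: Lang2002, VI §1 Thm. 1.14] -/
theorem cmFamilyRank_add_card_eq_of_conj_apply_eq_fiber [Nonempty I] (Φ : ∀ i, CMType (K i)) (κ : I → C)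
    (hκ : Function.Surjective κ)
    (hreal : ∀ c c', c ≠ c' → ∀ x : ℂ, x ∈ (⨆ i : {i : I // κ i = c}, normalClosure ℚ (K i.1) ℂ) →
      x ∈ (⨆ i : {i : I // κ i = c'}, normalClosure ℚ (K i.1) ℂ) → starRingEnd ℂ x = x) :
    cmFamilyRank Φ + Fintype.card C = (∑ c, cmFamilyRank fun i : {i : I // κ i = c} => Φ i.1) + 1 :=
  cmFamilyRank_add_card_eq_of_partialConj_fiber Φ κ hκ (exists_partialConj_fiber_of_conj_apply_eq κ hreal)

/-- **Nondegeneracy is decided on the blocks of any partition whose composita of Galois closures PAIRWISE meet in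
totally real fields**: `(Φ_i)_i` is nondegenerate iff every `(Φ_i)_{κ i = c}` is — on abelian varieties: `∏_i A_i` is
stably nondegenerate iff every `∏_{κ i = c} A_i` is. [cite: MoonenZarhin1999LowDim, §3 (3.1)] [cite: Gordon1999HodgeAVSurvey, 7.5] -/
theorem isNondegenerateFamily_iff_forall_fiber_of_conj_apply_eq [Nonempty I] (Φ : ∀ i, CMType (K i)) (κ : I → C)
    (hκ : Function.Surjective κ)
    (hreal : ∀ c c', c ≠ c' → ∀ x : ℂ, x ∈ (⨆ i : {i : I // κ i = c}, normalClosure ℚ (K i.1) ℂ) →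
      x ∈ (⨆ i : {i : I // κ i = c'}, normalClosure ℚ (K i.1) ℂ) → starRingEnd ℂ x = x) :
    IsNondegenerateFamily Φ ↔ ∀ c, IsNondegenerateFamily fun i : {i : I // κ i = c} => Φ i.1 :=
  isNondegenerateFamily_iff_forall_fiber_of_partialConj Φ κ hκ (exists_partialConj_fiber_of_conj_apply_eq κ hreal)

/-! ### §3 On abelian varieties -/

variable [Nonempty I] {Φ : ∀ i, CMType (K i)} {A : I → AbelianVariety ℂ}
  {ι : ∀ i, 𝓞 (K i) →+* End (A i)} {θ : ∀ i, K i →+* Module.End ℂ (complexBetti (A i).X 1)}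

/-- **The Hodge conjecture and `B• = D•` on every product `∏_j A_{π j}`, from the blocks**: realisations `A_i` of CM
types `Φ_i`, a partition `κ` of the slots whose composita of Galois closures pairwise meet in totally real fields, and
every block sub-family nondegenerate ⟹ every `⨁_{j<N} A_{π j}` satisfies the Hodge conjecture with all Hodge classes
polynomials in divisor classes. [cite: MoonenZarhin1999LowDim, §3 (3.1) and (3.9)] [cite: Gordon1999HodgeAVSurvey, 7.5 and 10.10] -/
theorem hodgeConjectureFor_prod_of_forall_fiber (κ : I → C) (hκ : Function.Surjective κ)
    (hreal : ∀ c c', c ≠ c' → ∀ x : ℂ, x ∈ (⨆ i : {i : I // κ i = c}, normalClosure ℚ (K i.1) ℂ) →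
      x ∈ (⨆ i : {i : I // κ i = c'}, normalClosure ℚ (K i.1) ℂ) → starRingEnd ℂ x = x)
    (hblock : ∀ c, IsNondegenerateFamily fun i : {i : I // κ i = c} => Φ i.1)
    (hA : ∀ i, IsCMTypeRealisation (Φ i) (A i) (ι i) (θ i)) {N : ℕ} (π : Fin N → I) :
    HodgeConjectureFor (⨁ fun j : Fin N => A (π j)).dim (⨁ fun j : Fin N => A (π j)).X ∧
      ∀ m : ℕ, hodgeClassSpan (⨁ fun j : Fin N => A (π j)).dim (⨁ fun j : Fin N => A (π j)).X m =
        divisorClassesSpan (⨁ fun j : Fin N => A (π j)).X (⨁ fun j : Fin N => A (π j)).dim m :=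
  have hnd : IsNondegenerateFamily Φ :=
    (isNondegenerateFamily_iff_forall_fiber_of_conj_apply_eq Φ κ hκ hreal).2 hblock
  ⟨hnd.hodgeConjectureFor_prod hA π, fun m => hnd.hodgeClassSpan_prod_eq_divisorClassesSpan hA π m⟩

end CMAlgebra

end Literature.AlgebraicGeometry.Pohlmann1968

end
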